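import Summits.RiemannHypothesis.RiemannHypothesis.Theorems.PfPersistenceBarrierTwinsDials
import Literature.NumberTheory.LFunctions.WeilCombAutocorrelationBump
import HarnessLib

/-!
# PF-persistence BARRIER, IV: the criterion, its sharpness, and the RH-free non-positivity of twins

Framing (page 1 of every `pub-rhpf` file): **long-odds MECHANISM SEARCH — nothing here is a claim
about RH.**  Every RH-bearing proposition is an explicit HYPOTHESIS of a theorem or one side of a
proved `↔` with a tree theorem; the negativity of a control family is never asserted unless PROVED
(it enters as a hypothesis `… ∈ Neg`, documented as observatory DATA in
`run/shared/lean/pub/pub-rhpf/pub-rhpf-barrier-prover/PROOF-PLAN.md`).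

Contents (overview in `PfPersistenceBarrierWalls`): the Weil instance of the semantic wall W3,
`pfPersistence_criterion_iff_riemannHypothesis :
(∃ P, Discriminates P zetaDatum {F | ¬ F.Positivity}) ↔ RiemannHypothesis`; SHARPNESS — every
truncation `PositivityOn A` is window-local hence W1-dead, while the conjunction over `A`
discriminates iff RH (`forall_positivityOn_discriminates_iff`): positivity is a limit of local
invariants that is not local; and the RH-FREE negativity of heavy planted data
(`exists_plantedDatum_not_positivity`, bump-pair witness), whence the UNCONDITIONAL barrier
`no_windowLocal_criterion`: no window-local predicate at any cutoff discriminates `ζ` from the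
non-positive data.

References: E. Bombieri, Rend. Lincei (9) 11 (2000) 183–233, Thm 2 (bib `Bombieri2000Weil`);
H. G. Diamond, H. L. Montgomery, U. Vorhauer, Math. Ann. 334 (2006) 1–36, Thm 1 (Beurling primes
with RH_P false — the literature model of twins; tree
`Literature.Barriers.RiemannHypothesis.DiamondMontgomeryVorhauer2006_thm1`).
-/

set_option linter.dupNamespace false

noncomputable section

open MeasureTheory Set Filter Complex
open scoped Real Topology ComplexConjugate ContDiff

namespace Summit.RiemannHypothesis.RiemannHypothesis.Theorems.PfPersistenceBarrier

open Literature.NumberTheory.LFunctions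

open ExplicitDatum

/-! ### W3, Weil instance: the criterion, and sharpness -/

/-- **`pfPersistence_criterion_iff_weilPositivity`.** Against the SEMANTIC negative class (all
data failing window positivity somewhere), a discriminating invariant of `ζ`'s data exists iff
Weil positivity holds. [folklore] -/
theorem pfPersistence_criterion_iff_weilPositivity :
    (∃ P : ExplicitDatum → Prop, Discriminates P zetaDatum {F | ¬ F.Positivity}) ↔
      WeilPositivity := by
  rw [← zetaDatum_positivity_iff]
  exact exists_discriminates_iff

/-- … iff the Riemann hypothesis (tree: `weil_criterion_holds`). [cite: Bombieri2000Weil, Thm 2 (p. 193)] -/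
theorem pfPersistence_criterion_iff_riemannHypothesis :
    (∃ P : ExplicitDatum → Prop, Discriminates P zetaDatum {F | ¬ F.Positivity}) ↔
      RiemannHypothesis := by
  rw [pfPersistence_criterion_iff_weilPositivity]
  exact weil_criterion_holds.symm

/-- **W3 for any admissible class and any negative class containing the semantic one**: a
discriminator in the class proves RH; restricting the class never makes the criterion cheaper. [folklore] -/
theorem riemannHypothesis_of_discriminates {𝒞 : Set (ExplicitDatum → Prop)}
    {Neg : Set ExplicitDatum} (hNeg : ∀ F : ExplicitDatum, ¬ F.Positivity → F ∈ Neg)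
    (h : ∃ P ∈ 𝒞, Discriminates P zetaDatum Neg) : RiemannHypothesis :=
  zetaDatum_positivity_iff_riemannHypothesis.1 (pos_of_exists_discriminates_in_class hNeg h)

/-- **Sharpness (i): every truncation is W1-dead.** Window positivity up to `A` — the strongest
window-local invariant of `ζ` up to `A` one could hope to certify — does not discriminate `ζ` from
any negative class containing a twin below `2A`. [folklore] -/
theorem positivityOn_not_discriminates {A : ℝ} {Neg : Set ExplicitDatum} {G : ExplicitDatum}
    (hG : G ∈ Neg) (htwin : AgreeBelow zetaDatum G (2 * A)) (hs : zetaDatum.smooth = G.smooth) :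
    ¬ Discriminates (fun F ↦ F.PositivityOn A) zetaDatum Neg :=
  no_windowLocal_discriminator (positivityOn_isWindowLocal A) hG htwin hs

/-- **Sharpness (ii): the conjunction of the dead truncations is the live criterion.** The
all-windows conjunction `∀ A, PositivityOn A` discriminates `ζ` from the semantic negative class
iff RH: positivity is a LIMIT (intersection over `A`) of window-local invariants which is not
itself window-local. [folklore] -/
theorem forall_positivityOn_discriminates_iff :
    Discriminates (fun F : ExplicitDatum ↦ ∀ A, F.PositivityOn A) zetaDatum
        {F | ¬ F.Positivity} ↔ RiemannHypothesis := by
  have e : (fun F : ExplicitDatum ↦ ∀ A, F.PositivityOn A) = ExplicitDatum.Positivity :=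
    funext fun F ↦ propext (positivity_iff_forall_positivityOn F).symm
  rw [e, discriminates_self_iff (Pos := ExplicitDatum.Positivity) (Neg := {F | ¬ F.Positivity})
    (fun F hF ↦ hF), zetaDatum_positivity_iff_riemannHypothesis]

/-- **Sharpness (iii): no window-local class reaches the criterion.** If `Neg` contains, for every
cutoff `A`, a twin of `ζ` below `2A` (the observatory serves `planted`/`primedel`/Beurling twins at
every scale — DATA; here a hypothesis), then NO window-local predicate, at any cutoff,
discriminates; whereas (ii) the non-local conjunction does iff RH. [folklore] -/
theorem no_windowLocal_discriminator_of_twins_at_every_scale {Neg : Set ExplicitDatum}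
    (htwins : ∀ A : ℝ, ∃ G ∈ Neg, AgreeBelow zetaDatum G (2 * A) ∧ zetaDatum.smooth = G.smooth) :
    ¬ ∃ (A : ℝ) (P : ExplicitDatum → Prop), IsWindowLocal P A ∧ Discriminates P zetaDatum Neg := by
  rintro ⟨A, P, hP, hdisc⟩
  obtain ⟨G, hG, htwin, hs⟩ := htwins A
  exact no_windowLocal_discriminator hP hG htwin hs hdisc

/-- Twins at every scale exist inside the planted family: for every `A` the planted datum at
`y = 2A + 1` is a twin below `2A`.  (Its NEGATIVITY is data, not proved here.) [folklore] -/
theorem planted_twins_at_every_scale (w : ℂ) (A : ℝ) :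
    AgreeBelow zetaDatum (plantedDatum w (2 * A + 1)) (2 * A) :=
  zetaDatum_agreeBelow_plantedDatum w (by
    have : 2 * A < 2 * A + 1 := by linarith
    exact this.trans_le (le_abs_self _))

/-! ### The twins ARE negatives: RH-free non-positivity of heavy planted data

The negativity of the observatory's twin families is DATA in general; for the planted family it
is a THEOREM, free of RH: a heavy enough mass at `± y` makes the datum fail window positivity,
witnessed by a bump pair `g₀ = b + b(· − y)` whose autocorrelation is `≥ ∫ b² > 0` at `± y`.
Consequently W1 holds UNCONDITIONALLY against the semantic negative class in the continuum
model: positivity (`⇔ RH`) is not window-local at any cutoff. -/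

/-- The planted prime term splits off the planted mass (for compactly supported `k`). [folklore] -/
theorem plantedDatum_primeTerm (w : ℂ) (y : ℝ) {k : ℝ → ℂ} (hk : HasCompactSupport k) :
    (plantedDatum w y).primeTerm k = w * (k y + k (-y)) + weilPrimeTerm k := by
  rw [← zetaDatum_primeTerm]
  unfold ExplicitDatum.primeTerm
  have hz : Summable fun n : ℕ ↦ zetaDatum.wt n * (k (zetaDatum.pos n) + k (-zetaDatum.pos n)) :=
    summable_weilPrimeTerm hk
  have he : Summable fun n : ℕ ↦ if n = 0 then w * (k y + k (-y)) else 0 :=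
    summable_of_ne_finset_zero (s := {0}) fun n hn ↦ by
      rw [Finset.mem_singleton] at hn
      simp [hn]
  have hsplit : (fun n : ℕ ↦ (plantedDatum w y).wt n *
      (k ((plantedDatum w y).pos n) + k (-(plantedDatum w y).pos n))) =
      fun n ↦ (if n = 0 then w * (k y + k (-y)) else 0) +
        zetaDatum.wt n * (k (zetaDatum.pos n) + k (-zetaDatum.pos n)) := by
    funext n
    by_cases hn : n = 0
    · subst hn
      simp [plantedDatum, zetaDatum_wt_zero]
    · simp [plantedDatum, hn]
  rw [hsplit, he.tsum_add hz, tsum_ite_eq]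

/-- `Q_planted(g) = Q_ζ(g) − w · (k(y) + k(−y))`, `k = g ⋆ g̃`, for Weil tests `g`. [folklore] -/
theorem plantedDatum_quadratic (w : ℂ) (y : ℝ) {g : ℝ → ℂ} (hg : IsWeilTest g) :
    (plantedDatum w y).quadratic g =
      weilQuadratic g - w * (weilConv g (weilReflect g) y + weilConv g (weilReflect g) (-y)) := by
  have hk : HasCompactSupport (weilConv g (weilReflect g)) := (hg.weilConv hg.weilReflect).2
  have e1 : (plantedDatum w y).quadratic g = zetaDatum.smooth (weilConv g (weilReflect g)) -
      (plantedDatum w y).primeTerm (weilConv g (weilReflect g)) := rfl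
  have e2 : weilQuadratic g = zetaDatum.smooth (weilConv g (weilReflect g)) -
      weilPrimeTerm (weilConv g (weilReflect g)) := by
    rw [← zetaDatum_quadratic]; rfl
  rw [e1, e2, plantedDatum_primeTerm w y hk]
  ring

/-- **A Weil test seeing the lag `± y`.** For every `y` there is a Weil test function `g₀` (a real
bump plus its translate by `y`) with `Re ((g₀ ⋆ g̃₀)(y) + (g₀ ⋆ g̃₀)(−y)) > 0` (indeed `≥ 2 ∫ b²`).
[folklore] -/
theorem exists_isWeilTest_autocorr_pos (y : ℝ) :
    ∃ g : ℝ → ℂ, IsWeilTest g ∧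
      0 < (weilConv g (weilReflect g) y + weilConv g (weilReflect g) (-y)).re := by
  obtain ⟨b, hb, hbc, -, hb0, -, hpos⟩ := exists_real_bump
  have hbt : ContDiff ℝ ∞ fun u : ℝ ↦ b (u - y) := hb.comp (contDiff_id.sub contDiff_const)
  have hbtc : HasCompactSupport fun u : ℝ ↦ b (u - y) := by
    simpa [Function.comp_def, sub_eq_add_neg] using hbc.comp_homeomorph (Homeomorph.addRight (-y))
  set c : ℝ → ℝ := fun u ↦ b u + b (u - y) with hc
  have hcd : ContDiff ℝ ∞ c := hb.add hbt
  have hcc : HasCompactSupport c := hbc.add hbtc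
  have hccont : Continuous c := hcd.continuous
  refine ⟨fun t ↦ ((c t : ℝ) : ℂ), ⟨?_, ?_⟩, ?_⟩
  · exact Complex.ofRealCLM.contDiff.comp hcd
  · exact hcc.comp_left (g := Complex.ofReal) Complex.ofReal_zero
  · rw [weilConv_ofReal_eq c y, weilConv_ofReal_eq c (-y), ← Complex.ofReal_add, Complex.ofReal_re]
    -- both autocorrelations dominate `∫ b²`
    have hb2c : HasCompactSupport fun u ↦ b u ^ 2 := by
      have : (fun u ↦ b u ^ 2) = fun u ↦ b u * b u := by funext u; ring
      rw [this]; exact hbc.mul_right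
    have hb2 : Integrable fun u ↦ b u ^ 2 := (hb.continuous.pow 2).integrable_of_hasCompactSupport hb2c
    have hint : ∀ v : ℝ, Integrable fun u ↦ c u * c (u - v) := fun v ↦
      (hccont.mul (hccont.comp (continuous_id.sub continuous_const))).integrable_of_hasCompactSupport
        hcc.mul_right
    have i1 : ∫ u, b u ^ 2 ≤ ∫ u, c u * c (u - y) := by
      rw [← integral_sub_right_eq_self (fun u ↦ b u ^ 2) y]
      refine integral_mono (hb2.comp_sub_right y) (hint y) fun u ↦ ?_
      have h1 := hb0 u
      have h2 := hb0 (u - y)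
      have h3 := hb0 (u - y - y)
      show b (u - y) ^ 2 ≤ (b u + b (u - y)) * (b (u - y) + b (u - y - y))
      nlinarith [mul_nonneg h1 h2, mul_nonneg h1 h3, mul_nonneg h2 h3]
    have i2 : ∫ u, b u ^ 2 ≤ ∫ u, c u * c (u - -y) := by
      refine integral_mono hb2 (hint (-y)) fun u ↦ ?_
      have h1 := hb0 u
      have h2 := hb0 (u - y)
      have h3 := hb0 (u - -y)
      have e : u - -y - y = u := by ring
      show b u ^ 2 ≤ (b u + b (u - y)) * (b (u - -y) + b (u - -y - y))
      rw [e]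
      nlinarith [mul_nonneg h1 h2, mul_nonneg h1 h3, mul_nonneg h2 h3]
    linarith

/-- **Heavy planted data are not positive (RH-free).** For every position `y`, beyond a weight
threshold the planted datum fails window positivity: `Re Q_planted(g₀) = Re Q_ζ(g₀) − w · Re K < 0`
with `K = k₀(y) + k₀(−y)`, `Re K > 0`. [folklore] -/
theorem exists_plantedDatum_not_positivity (y : ℝ) :
    ∃ w₀ : ℝ, ∀ w : ℝ, w₀ < w → ¬ (plantedDatum (w : ℂ) y).Positivity := by
  obtain ⟨g, hg, hK⟩ := exists_isWeilTest_autocorr_pos y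
  refine ⟨(weilQuadratic g).re /
      (weilConv g (weilReflect g) y + weilConv g (weilReflect g) (-y)).re, fun w hw hpos ↦ ?_⟩
  have h := hpos g hg
  rw [plantedDatum_quadratic (w : ℂ) y hg, Complex.sub_re, Complex.re_ofReal_mul] at h
  have hw' := (div_lt_iff₀ hK).1 hw
  linarith

/-- **Non-positive twins at every scale (RH-free).** For every cutoff `A` some NON-POSITIVE datum
has exactly `ζ`'s windows up to `A` (a heavy planted mass at `y = 2A + 1`). [folklore] -/
theorem exists_nonpositive_twin (A : ℝ) :
    ∃ G : ExplicitDatum, AgreeBelow zetaDatum G (2 * A) ∧ zetaDatum.smooth = G.smooth ∧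
      ¬ G.Positivity := by
  obtain ⟨w₀, hw₀⟩ := exists_plantedDatum_not_positivity (2 * A + 1)
  exact ⟨plantedDatum ((w₀ + 1 : ℝ) : ℂ) (2 * A + 1), planted_twins_at_every_scale _ A, rfl,
    hw₀ _ (by linarith)⟩

/-- **W1, unconditional form: positivity is not window-local.** No predicate window-local up to
any cutoff `A` discriminates `ζ` from the non-positive data — every window-local invariant of `ζ`
is shared by a datum failing Weil positivity; compare `forall_positivityOn_discriminates_iff`
(the non-local conjunction discriminates iff RH) and `pfPersistence_criterion_iff_weilPositivity`.
[folklore] -/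
theorem no_windowLocal_discriminator_semantic (A : ℝ) {P : ExplicitDatum → Prop}
    (hP : IsWindowLocal P A) : ¬ Discriminates P zetaDatum {F | ¬ F.Positivity} := by
  obtain ⟨G, htwin, hs, hG⟩ := exists_nonpositive_twin A
  exact no_windowLocal_discriminator hP hG htwin hs

/-- … nor from any negative class containing the non-positive data. [folklore] -/
theorem no_windowLocal_discriminator_of_nonpositive_mem (A : ℝ) {P : ExplicitDatum → Prop}
    (hP : IsWindowLocal P A) {Neg : Set ExplicitDatum}
    (hNeg : ∀ F : ExplicitDatum, ¬ F.Positivity → F ∈ Neg) : ¬ Discriminates P zetaDatum Neg := by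
  obtain ⟨G, htwin, hs, hG⟩ := exists_nonpositive_twin A
  exact no_windowLocal_discriminator hP (hNeg G hG) htwin hs

/-- **The barrier in one line (continuum model, RH-free).** There is no cutoff `A` and no
window-local predicate up to `A` discriminating `ζ` from the non-positive data; the class of
window-local predicates (all cutoffs) contains no PF-persistence criterion. [folklore] -/
theorem no_windowLocal_criterion :
    ¬ ∃ (A : ℝ) (P : ExplicitDatum → Prop),
      IsWindowLocal P A ∧ Discriminates P zetaDatum {F | ¬ F.Positivity} :=
  fun ⟨A, _, hP, hdisc⟩ ↦ no_windowLocal_discriminator_semantic A hP hdisc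

/-- Yet window-local invariants of `ζ` do hold with content: window positivity up to
`A = (log 2)/2` is a THEOREM of the tree (`weilPositivityOn_of_le_log_two_half`, RH-free) — true at
`ζ`, shared by a non-positive twin, discriminating nothing. [folklore] -/
theorem zetaDatum_positivityOn_log_two_half : zetaDatum.PositivityOn (Real.log 2 / 2) :=
  (zetaDatum_positivityOn_iff _).2 (weilPositivityOn_of_le_log_two_half le_rfl)

/-! ### Sharpness packaged: the window-local class is not sequentially closed "up to RH" -/

/-- PROVED: window positivity is monotone in the cutoff. [folklore] -/
theorem ExplicitDatum.PositivityOn.anti {F : ExplicitDatum} {A A' : ℝ} (h : F.PositivityOn A')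
    (hA : A ≤ A') : F.PositivityOn A :=
  fun g hg hs ↦ h g hg (hs.trans (Icc_subset_Icc (neg_le_neg hA) hA))

/-- PROVED: positivity is the COUNTABLE conjunction of the window positivities at integer
cutoffs. [folklore] -/
theorem ExplicitDatum.positivity_iff_forall_nat_positivityOn (F : ExplicitDatum) :
    F.Positivity ↔ ∀ n : ℕ, F.PositivityOn n := by
  rw [positivity_iff_forall_positivityOn]
  exact ⟨fun h n ↦ h n, fun h A ↦ (h ⌈A⌉₊).anti (Nat.le_ceil A)⟩

/-- **PROVED (W1 + its sharpness in one statement, continuum model).** (a) RH-free: NO member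
of the window-local class (any cutoff) discriminates `ζ` from the non-positive data; (b) there IS
a sequence `P n` of members, `P n` window-local at cutoff `n`, whose countable conjunction
discriminates — iff RH.  Positivity is a sequential LIMIT of the class, not a member; the class
is not closed under countable conjunction short of deciding RH. [folklore] -/
theorem windowLocal_class_limit_dichotomy :
    (¬ ∃ (A : ℝ) (P : ExplicitDatum → Prop),
        IsWindowLocal P A ∧ Discriminates P zetaDatum {F | ¬ F.Positivity}) ∧
    ((∃ P : ℕ → ExplicitDatum → Prop, (∀ n, IsWindowLocal (P n) n) ∧
        Discriminates (fun F ↦ ∀ n, P n F) zetaDatum {F | ¬ F.Positivity}) ↔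
      RiemannHypothesis) := by
  refine ⟨no_windowLocal_criterion, ⟨fun ⟨P, _, hdisc⟩ ↦ ?_, fun hRH ↦ ?_⟩⟩
  · exact pfPersistence_criterion_iff_riemannHypothesis.1 ⟨_, hdisc⟩
  · refine ⟨fun n F ↦ F.PositivityOn n, fun n ↦ positivityOn_isWindowLocal n, ?_⟩
    have e : (fun F : ExplicitDatum ↦ ∀ n : ℕ, F.PositivityOn n) = ExplicitDatum.Positivity :=
      funext fun F ↦ propext (F.positivity_iff_forall_nat_positivityOn).symm
    rw [e, discriminates_self_iff (Pos := ExplicitDatum.Positivity) (Neg := {F | ¬ F.Positivity})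
      (fun F hF ↦ hF), zetaDatum_positivity_iff_riemannHypothesis]
    exact hRH

end Summit.RiemannHypothesis.RiemannHypothesis.Theorems.PfPersistenceBarrier

end
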